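import Literature.AlgebraicGeometry.Frobenioids.PadicKummerRelCosetGaloisFields
import HarnessLib

/-!
# Frobenioids II, Def. 2.2 (i) over a GENERAL base `D = B^temp(Π, Π°)⁰ → E = B^temp(G, G°)⁰` of §2: the Galois chart
# `Aut_C(A) ↠ G_A ⥲ Aut_E(A_E) = Gal(K_A/K)` of an object, its Definition 2.2 context, and Theorem 2.4 (i) for such objects

Mochizuki, *The geometry of Frobenioids II*, Kyushu J. Math. **62** (2008) 401–460, §2 p. 17 and Definition 2.2 (i)
p. 17 [cite: MochizukiFrdII2008, Def 2.2 (i) p.17]: "the natural action by conjugation of `Aut_C(A)` on `O^×(A)`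
(`⊆ Aut_C(A)`) factors through the quotient `Aut_C(A) ↠ G_A := Aut_C(A)/(Ker(Aut_C(A) → Aut_E(A_E)))` induced by the
functor `C → E`. Moreover, the functor `C → E` induces a natural inclusion `G_A ↪ Aut_E(A_E)`, which is an isomorphism
if, for instance, `A_D` is Galois [where we recall that `C` is `Aut`-ample — cf. Theorem 1.2, (i)]. If `A_D` is Galois,
then we have a natural surjective outer homomorphism `G ↠ Aut_E(A_E) ⥲ G_A`"; Theorem 2.4 (i) p. 19
[cite: MochizukiFrdII2008, Thm 2.4 (i) p.19] ("`Dᵢ = B^temp(Πᵢ, Πᵢ°)⁰` … where `Πᵢ → Qᵢ := G_{ℚ_{pᵢ}}` is an open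
homomorphism").

Definitions file (seat abc-iut-L1-t7, gen 5; the successor residual "general `Π ≠ G_{ℚ_p}` base chart" of GAP row
G-L1t7-α, SUBDAG-FrdII-Thm24 v-log 06:40Z). Abc-iut-L1-t7 gen 4's chart machinery (`PadicFrd.Datum.GaloisChart`, files
D2/D3 `PadicKummerGaloisChart.lean`) is base-agnostic but was INSTANTIATED only for `Π = G_{ℚ_p}` (file D3b, base field
`ℚ_p`). Here, for a `p`-adic Frobenioid `d` over `hd : d.base = PadicFrd.relBaseGal p Π° φ₀ hφ₀` (abc-iut-L1-t4's
realisation of print's `D → E → D₀` for an arbitrary open homomorphism `φ₀ : Π → G_{ℚ_p}`) and an object `A` with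
`A_D = Π/V` Galois (`V ⊴ Π`), over the base field `K = ℚ̄_p^{φ₀(Π)}` of the companion file
`PadicKummerRelCosetGaloisFields.lean`:

* `resK : Aut_C(A) → Gal(K_A/K)` — "`Aut_C(A) → Aut_E(A_E)`" (`Aut_E(A_E) = Aut(G/φ₀(V)) = G/φ₀(V) = Gal(K_A/K)`): for
  `Base(α⁻¹)(1·V) = π·V` it is `φ₀(π)|_{K_A}` (`coe_resK_apply`); it IS the field map of `Base(α⁻¹)` read on `K_A`
  (`resK_twist_fldEquiv`);
* `resK_eq_one_iff` — **its kernel, honestly**: `α ∈ Ker` iff `Base(α⁻¹)` pushes forward to the IDENTITY of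
  `A_E` — for a general `Π` this kernel is LARGER than `O^×(A)` (it contains every lift of `(V·Ker φ₀ ∩ N_Π(V))/V`), so
  print's `G_A` is a proper quotient of `Aut_C(A)/O^×(A)` in general (contrast file D3b's `resAut_eq_one_iff` for
  `Π = G_{ℚ_p}`);
* `resK_surjective` — **"`G_A ⥲ Aut_E(A_E)` if `A_D` is Galois [`C` is `Aut`-ample]"**: `σ ∈ Gal(K_A/K)` extends to
  `Gal(ℚ̄_p/K) = φ₀(Π)` (Mathlib `AlgEquiv.liftNormal`), `= φ₀(π)`; right translation by `π` is an automorphism of `Π/V`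
  (`V ⊴ Π`), lifted to `Aut_C(A)` by abc-iut-L1-t4's `thm12_isAutAmple`;
* `galoisChartRel` — the `GaloisChart d A K L` of file D2 (`L ≅ K_A` inside Mathlib's `K̄` through `closureEquiv`),
  hence `contextOfObjectRel` (**Definition 2.2 for an object over a general §2 base**, an instance of abc-iut-L1-t7's
  Galois binding `Def22Context.ofGalois` with `G := G_K`, `K = ℚ̄_p^{Im(Π)}` — print's "`G := Im(Π)`, `K` the finite
  extension of `ℚ_p` determined by `G`") and **`thm24i_ofObjectsRel`: Theorem 2.4 (i) for two objects of `pᵢ`-adic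
  Frobenioids over `B^temp(Πᵢ, Πᵢ°)⁰`, GENERAL `Πᵢ → G_{ℚ_{pᵢ}}`**, and any isomorphism of their contexts, conditional
  on EXACTLY `hfs` (everything else constructed/proved by files D2/D3 and the Galois-binding theorems).
Classical Galois theory; nothing here concerns [IUTchIII]; no statement of the paper is strengthened; universe `0`.
-/

noncomputable section

namespace Literature.AlgebraicGeometry.Frobenioids

namespace PadicFrd

namespace RelGal

open CategoryTheory Opposite Function Field IntermediateField
open Literature.AnabelianGeometry.SemiGraphs QuasiTemperoid

variable {p : ℕ} [Fact p.Prime] {P : Type} [Group P] [TopologicalSpace P]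
  (φ₀ : P →* GalFbar ℚ_[p]) (hφ₀ : IsOpenHom φ₀) {P₀ : OpenSubgroup P}
  (d : Datum (RelCosetCat P₀) p) (hd : d.base = relBaseGal p P₀ φ₀ hφ₀) (A : d.frobenioid)

/-! ### `Aut_C(A) → Aut_E(A_E) = Gal(K_A/K)` -/

/-- A representative `π ∈ Π` of the image `π·V` of `1·V` under an endomorphism of `A_D = Π/V`.
[cite: MochizukiFrdII2008, Def 2.2 (i) p.17] -/
theorem exists_coe_eq_pt (h : A.base.obj ⟶ A.base.obj) : ∃ π : P, (π : A.base.obj.carrier) = CosetCat.pt h :=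
  QuotientGroup.mk_surjective _

/-- **The `K`-algebra endomorphism of `K_A` induced by an endomorphism `h` of `A_D`** through `D → E → D₀` (the field
map of the base functor, read on `K_A` through `twist`); it is `φ₀(π)|_{K_A}` for `h(1·V) = π·V`, and `φ₀(π) ∈ G`
fixes `K`. [cite: MochizukiFrdII2008, Def 2.2 (i) p.17] -/
def fieldAlgHomK (h : A.base.obj ⟶ A.base.obj) :
    ↥(objFldK φ₀ hφ₀ d A) →ₐ[baseFld p φ₀ hφ₀] ↥(objFldK φ₀ hφ₀ d A) :=
  { ((twist φ₀ hφ₀ d A).toRingHom.comp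
      (fieldMap ((CosetCat.toConnected (isTempered_galFbar ℚ_[p])).map
        ((CosetCat.push φ₀ hφ₀.isOpenMap).map h))).toRingHom).comp (twist φ₀ hφ₀ d A).symm.toRingHom with
    commutes' := fun k => by
      obtain ⟨π, hπ⟩ := exists_coe_eq_pt d A h
      apply Subtype.ext
      change ((twist φ₀ hφ₀ d A (fieldMap ((CosetCat.toConnected (isTempered_galFbar ℚ_[p])).map
        ((CosetCat.push φ₀ hφ₀.isOpenMap).map h)) ((twist φ₀ hφ₀ d A).symm
          (algebraMap (baseFld p φ₀ hφ₀) (objFldK φ₀ hφ₀ d A) k))) : objFldK φ₀ hφ₀ d A) : Fbar ℚ_[p]) = _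
      rw [coe_twist_fieldMap_push φ₀ hφ₀ d A h π hπ]
      exact (mem_baseFld_iff p φ₀ hφ₀ _).mp k.2 π }

/-- Its values: `φ₀(π)·b` for ANY `π` with `h(1·V) = π·V`. [cite: MochizukiFrdII2008, Def 2.2 (i) p.17] -/
theorem coe_fieldAlgHomK_apply (h : A.base.obj ⟶ A.base.obj) (π : P) (hπ : (π : A.base.obj.carrier) = CosetCat.pt h)
    (b : objFldK φ₀ hφ₀ d A) : ((fieldAlgHomK φ₀ hφ₀ d A h b : objFldK φ₀ hφ₀ d A) : Fbar ℚ_[p]) = φ₀ π (b : Fbar ℚ_[p]) :=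
  coe_twist_fieldMap_push φ₀ hφ₀ d A h π hπ b

/-- Identity: `π = 1`. [cite: MochizukiFrdII2008, Def 2.2 (i) p.17] -/
theorem fieldAlgHomK_id : fieldAlgHomK φ₀ hφ₀ d A (𝟙 A.base.obj) = AlgHom.id (baseFld p φ₀ hφ₀) (objFldK φ₀ hφ₀ d A) := by
  apply AlgHom.ext
  intro b
  apply Subtype.ext
  rw [coe_fieldAlgHomK_apply φ₀ hφ₀ d A _ 1 (by rw [CosetCat.pt_id]), map_one, AlgEquiv.one_apply]
  rfl

/-- Composition (contravariance of `Spec`): the representative of `(h ≫ h')(1·V)` is `π π'`.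
[cite: MochizukiFrdII2008, Def 2.2 (i) p.17] -/
theorem fieldAlgHomK_comp (h h' : A.base.obj ⟶ A.base.obj) :
    fieldAlgHomK φ₀ hφ₀ d A (h ≫ h') = (fieldAlgHomK φ₀ hφ₀ d A h).comp (fieldAlgHomK φ₀ hφ₀ d A h') := by
  obtain ⟨π, hπ⟩ := exists_coe_eq_pt d A h
  obtain ⟨π', hπ'⟩ := exists_coe_eq_pt d A h'
  have hππ' : ((π * π' : P) : A.base.obj.carrier) = CosetCat.pt (h ≫ h') := by
    rw [CosetCat.pt_comp, ← hπ, CosetCat.toFun_coe, ← hπ', MulAction.Quotient.smul_coe, smul_eq_mul]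
  apply AlgHom.ext
  intro b
  apply Subtype.ext
  rw [coe_fieldAlgHomK_apply φ₀ hφ₀ d A _ _ hππ', AlgHom.comp_apply, coe_fieldAlgHomK_apply φ₀ hφ₀ d A _ _ hπ,
    coe_fieldAlgHomK_apply φ₀ hφ₀ d A _ _ hπ', map_mul, AlgEquiv.mul_apply]

/-- It is bijective (`K_A/K` is finite). [cite: MochizukiFrdII2008, Def 2.2 (i) p.17] -/
theorem fieldAlgHomK_bijective (h : A.base.obj ⟶ A.base.obj) : Bijective (fieldAlgHomK φ₀ hφ₀ d A h) := by
  haveI := finiteDimensional_objFldK φ₀ hφ₀ d A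
  have hinj : Injective (fieldAlgHomK φ₀ hφ₀ d A h) := (fieldAlgHomK φ₀ hφ₀ d A h).toRingHom.injective
  exact ⟨hinj, (fieldAlgHomK φ₀ hφ₀ d A h).toLinearMap.injective_iff_surjective.mp hinj⟩

/-- **`Aut_C(A) → Aut_E(A_E) = Gal(K_A/K)`**, `α ↦` the field map of `Base(α⁻¹)` on `K_A` (Def. 2.2 (i): "induced by the
functor `C → E`"). [cite: MochizukiFrdII2008, Def 2.2 (i) p.17] -/
def resK : Aut A →* (↥(objFldK φ₀ hφ₀ d A) ≃ₐ[baseFld p φ₀ hφ₀] ↥(objFldK φ₀ hφ₀ d A)) where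
  toFun α := AlgEquiv.ofBijective (fieldAlgHomK φ₀ hφ₀ d A (ModelFrobenioid.baseMap α.inv).hom)
    (fieldAlgHomK_bijective φ₀ hφ₀ d A _)
  map_one' := by
    apply AlgEquiv.ext
    intro a
    change fieldAlgHomK φ₀ hφ₀ d A (ModelFrobenioid.baseMap (1 : Aut A).inv).hom a = a
    have h1 : (1 : Aut A).inv = 𝟙 A := rfl
    rw [h1, ModelFrobenioid.baseMap_id, ObjectProperty.FullSubcategory.id_hom, fieldAlgHomK_id]
    rfl
  map_mul' x y := by
    apply AlgEquiv.ext
    intro a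
    change fieldAlgHomK φ₀ hφ₀ d A (ModelFrobenioid.baseMap (x * y).inv).hom a =
      fieldAlgHomK φ₀ hφ₀ d A (ModelFrobenioid.baseMap x.inv).hom
        (fieldAlgHomK φ₀ hφ₀ d A (ModelFrobenioid.baseMap y.inv).hom a)
    have hxy : (x * y).inv = x.inv ≫ y.inv := rfl
    rw [hxy, ModelFrobenioid.baseMap_comp, ObjectProperty.FullSubcategory.comp_hom, fieldAlgHomK_comp]
    rfl

/-- **Values of `resK`**: for `Base(α⁻¹)(1·V) = π·V`, `resK α` is `φ₀(π)` on `K_A`. [cite: MochizukiFrdII2008, Def 2.2 (i) p.17] -/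
theorem coe_resK_apply (α : Aut A) (π : P) (hπ : (π : A.base.obj.carrier) = CosetCat.pt (ModelFrobenioid.baseMap α.inv).hom)
    (b : objFldK φ₀ hφ₀ d A) : ((resK φ₀ hφ₀ d A α b : objFldK φ₀ hφ₀ d A) : Fbar ℚ_[p]) = φ₀ π (b : Fbar ℚ_[p]) :=
  coe_fieldAlgHomK_apply φ₀ hφ₀ d A _ π hπ b

/-- **`resK α` IS the field map of `Base(α⁻¹)`** (the structure field `res_apply` of a Galois chart), read on `K_A`
through `d.fld A_D ≅ g₁·K_A ≅ K_A`. [cite: MochizukiFrdII2008, Def 2.2 (i) p.17] -/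
theorem resK_twist_fldEquiv (α : Aut A) (x : d.fld A.base) :
    resK φ₀ hφ₀ d A α (twist φ₀ hφ₀ d A (fldEquiv φ₀ hφ₀ d hd A x)) =
      twist φ₀ hφ₀ d A (fldEquiv φ₀ hφ₀ d hd A ((d.toBaseZero.map α.inv).alg x)) := by
  obtain ⟨π, hπ⟩ := exists_coe_eq_pt d A (ModelFrobenioid.baseMap α.inv).hom
  apply Subtype.ext
  rw [coe_resK_apply φ₀ hφ₀ d A α π hπ]
  exact (coe_twist_fldEquiv_base_map φ₀ hφ₀ d hd A (ModelFrobenioid.baseMap α.inv) π hπ x).symm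

/-! ### The kernel: `G_A := Aut_C(A)/Ker(Aut_C(A) → Aut_E(A_E))` -/

/-- **`Ker(Aut_C(A) → Aut_E(A_E))`, honestly**: `resK α = 1` iff `Base(α⁻¹) : Π/V → Π/V` pushes forward to the identity
of `A_E = G_{ℚ_p}/φ₀(V)` — i.e. iff `φ₀(π) ∈ φ₀(V)` for `Base(α⁻¹)(1·V) = π·V`. For `Π ≠ G_{ℚ_p}` this is weaker than
"`α` is a unit" (every lift of an element of `(V · Ker φ₀ ∩ N_Π(V))/V` lies in the kernel): print's `G_A` is a proper
quotient of `Aut_C(A)/O^×(A)` in general. [cite: MochizukiFrdII2008, Def 2.2 (i) p.17] -/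
theorem resK_eq_one_iff (α : Aut A) : resK φ₀ hφ₀ d A α = 1 ↔
    (CosetCat.push φ₀ hφ₀.isOpenMap).map (ModelFrobenioid.baseMap α.inv).hom = 𝟙 _ := by
  haveI : IsGalois ℚ_[p] (Fbar ℚ_[p]) := {}
  obtain ⟨π, hπ⟩ := exists_coe_eq_pt d A (ModelFrobenioid.baseMap α.inv).hom
  have hpt : CosetCat.pt ((CosetCat.push φ₀ hφ₀.isOpenMap).map (ModelFrobenioid.baseMap α.inv).hom) =
      ((φ₀ π : GalFbar ℚ_[p]) : (objCoset φ₀ hφ₀ d A).carrier) := by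
    rw [CosetCat.pt_push_map, ← hπ, CosetCat.pushQuot_coe]
  -- `push (Base α⁻¹) = 𝟙` iff `φ₀ π ∈ φ₀(V)`
  have hiff : (CosetCat.push φ₀ hφ₀.isOpenMap).map (ModelFrobenioid.baseMap α.inv).hom = 𝟙 _ ↔
      φ₀ π ∈ CosetCat.mapOpen φ₀ hφ₀.isOpenMap A.base.obj.sg := by
    constructor
    · intro h1
      have h2 := congrArg CosetCat.pt h1
      rw [hpt, CosetCat.pt_id, QuotientGroup.eq, mul_one, inv_mem_iff] at h2
      exact h2
    · intro h1
      apply CosetCat.hom_ext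
      rw [hpt, CosetCat.pt_id, QuotientGroup.eq, mul_one, inv_mem_iff]
      exact h1
  rw [hiff]
  constructor
  · intro h1
    -- `φ₀ π` fixes `K_A = ℚ̄_p^{φ₀(V)}` pointwise, and `φ₀(V)` is closed
    have hfix : φ₀ π ∈ (objFld φ₀ hφ₀ d A).fixingSubgroup := by
      rw [IntermediateField.mem_fixingSubgroup_iff]
      intro x hx
      have h2 := AlgEquiv.congr_fun h1 ⟨x, (mem_objFldK_iff φ₀ hφ₀ d A x).mpr hx⟩
      rw [AlgEquiv.one_apply] at h2
      have h3 := congrArg (fun y : objFldK φ₀ hφ₀ d A => (y : Fbar ℚ_[p])) h2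
      simpa only [coe_resK_apply φ₀ hφ₀ d A α π hπ] using h3
    have hcl : (objFld φ₀ hφ₀ d A).fixingSubgroup = (CosetCat.mapOpen φ₀ hφ₀.isOpenMap A.base.obj.sg).toSubgroup :=
      InfiniteGalois.fixingSubgroup_fixedField ⟨(CosetCat.mapOpen φ₀ hφ₀.isOpenMap A.base.obj.sg).toSubgroup,
        Subgroup.isClosed_of_isOpen _ (CosetCat.mapOpen φ₀ hφ₀.isOpenMap A.base.obj.sg).isOpen⟩
    rw [hcl] at hfix
    exact hfix
  · intro h1
    apply AlgEquiv.ext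
    intro b
    apply Subtype.ext
    rw [coe_resK_apply φ₀ hφ₀ d A α π hπ, AlgEquiv.one_apply]
    have hb : (b : Fbar ℚ_[p]) ∈ objFld φ₀ hφ₀ d A := (mem_objFldK_iff φ₀ hφ₀ d A _).mp b.2
    rw [objFld, IntermediateField.mem_fixedField_iff] at hb
    exact hb _ h1

/-! ### Surjectivity: "`G_A ⥲ Aut_E(A_E)` if `A_D` is Galois" -/

/-- For `V ⊴ Π`, right translation `gV ↦ gπV` is a well-defined `Π`-map `Π/V → Π/V` (its value at `1·V` is `π·V`).
[cite: MochizukiFrdII2008, Def 2.2 (i) p.17] -/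
theorem smul_coe_eq_coe_of_normal (hA : A.base.obj.sg.toSubgroup.Normal) (π : P) :
    ∀ u ∈ A.base.obj.sg, u • ((π : P) : A.base.obj.carrier) = ((π : P) : A.base.obj.carrier) := by
  intro u hu
  rw [MulAction.Quotient.smul_coe, smul_eq_mul, QuotientGroup.eq, show (u * π)⁻¹ * π = π⁻¹ * u⁻¹ * π by group]
  exact hA.conj_mem' u⁻¹ (inv_mem hu) π

/-- **Right translation by `π` as an automorphism of `A_D = Π/V` in `D = B^temp(Π, Π°)⁰`** (`V ⊴ Π`; inverse: translation
by `π⁻¹`), with `inv(1·V) = π·V`. [cite: MochizukiFrdII2008, Def 2.2 (i) p.17] -/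
def baseAutOfNormal (hA : A.base.obj.sg.toSubgroup.Normal) (π : P) : A.base ≅ A.base :=
  (CosetCat.admitsHomTo P₀).isoMk
    { hom := CosetCat.homMk ((π⁻¹ : P) : A.base.obj.carrier) (smul_coe_eq_coe_of_normal d A hA π⁻¹)
      inv := CosetCat.homMk ((π : P) : A.base.obj.carrier) (smul_coe_eq_coe_of_normal d A hA π)
      hom_inv_id := CosetCat.hom_ext (by
        rw [CosetCat.pt_comp, CosetCat.pt_homMk, CosetCat.homMk_toFun_coe, MulAction.Quotient.smul_coe, smul_eq_mul,
          inv_mul_cancel, CosetCat.pt_id])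
      inv_hom_id := CosetCat.hom_ext (by
        rw [CosetCat.pt_comp, CosetCat.pt_homMk, CosetCat.homMk_toFun_coe, MulAction.Quotient.smul_coe, smul_eq_mul,
          mul_inv_cancel, CosetCat.pt_id]) }

/-- `inv(1·V) = π·V`. [cite: MochizukiFrdII2008, Def 2.2 (i) p.17] -/
theorem pt_baseAutOfNormal_inv (hA : A.base.obj.sg.toSubgroup.Normal) (π : P) :
    CosetCat.pt (baseAutOfNormal d A hA π).inv.hom = ((π : P) : A.base.obj.carrier) :=
  CosetCat.pt_homMk _ (smul_coe_eq_coe_of_normal d A hA π)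

/-- **"`G_A ↪ Aut_E(A_E)` is an isomorphism if `A_D` is Galois [`C` is `Aut`-ample — Theorem 1.2 (i)]"**: every
`σ ∈ Gal(K_A/K)` extends to an element of `Gal(ℚ̄_p/K) = G = φ₀(Π)`, say `φ₀(π)`; translation by `π` is an automorphism
of `A_D` (`V ⊴ Π`), which lifts to `Aut_C(A)` (abc-iut-L1-t4's `thm12_isAutAmple`), and the lift maps to `σ`.
[cite: MochizukiFrdII2008, Def 2.2 (i) p.17] -/
theorem resK_surjective (hA : A.base.obj.sg.toSubgroup.Normal) : Surjective (resK φ₀ hφ₀ d A) := by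
  intro σ
  haveI : Normal (baseFld p φ₀ hφ₀) (Fbar ℚ_[p]) := (isGalois_baseFld p φ₀ hφ₀).to_normal
  -- extend `σ` to `ℚ̄_p` over `K`; it is `φ₀ π`
  obtain ⟨π, hπ⟩ := exists_map_eq_restrictScalars p φ₀ hφ₀ (σ.liftNormal (Fbar ℚ_[p]))
  -- lift translation by `π` to `Aut_C(A)`
  obtain ⟨α, hα⟩ := d.thm12_isAutAmple A (baseAutOfNormal d A hA π)
  refine ⟨α, ?_⟩
  have hinv : ModelFrobenioid.baseMap α.inv = (baseAutOfNormal d A hA π).inv := congrArg Iso.inv hα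
  apply AlgEquiv.ext
  intro b
  apply Subtype.ext
  rw [coe_resK_apply φ₀ hφ₀ d A α π (by rw [hinv, pt_baseAutOfNormal_inv]), hπ]
  exact σ.liftNormal_commutes (Fbar ℚ_[p]) b

/-! ### The chart (over Mathlib's `K̄` through `closureEquiv`) -/

/-- `K_A` transported into Mathlib's algebraic closure `K̄` of `K` (the type in which abc-iut-L1-t7's `Def22Context.ofGalois`
reads `L` and `G_K = Gal(K̄/K)`). [cite: MochizukiFrdII2008, Rmk 2.2.1 p.18] -/
def objL : IntermediateField (baseFld p φ₀ hφ₀) (AlgebraicClosure (baseFld p φ₀ hφ₀)) :=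
  (objFldK φ₀ hφ₀ d A).map (closureEquiv p φ₀ hφ₀).symm.toAlgHom

/-- `K_A ≅ L` over `K`. [cite: MochizukiFrdII2008, Rmk 2.2.1 p.18] -/
def objLEquiv : ↥(objFldK φ₀ hφ₀ d A) ≃ₐ[baseFld p φ₀ hφ₀] ↥(objL φ₀ hφ₀ d A) :=
  intermediateFieldMap (closureEquiv p φ₀ hφ₀).symm (objFldK φ₀ hφ₀ d A)

/-- `L` is finite over `K`. [cite: MochizukiFrdII2008, Rmk 2.2.1 p.18] -/
theorem finiteDimensional_objL : FiniteDimensional (baseFld p φ₀ hφ₀) (objL φ₀ hφ₀ d A) :=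
  haveI := finiteDimensional_objFldK φ₀ hφ₀ d A
  LinearEquiv.finiteDimensional (objLEquiv φ₀ hφ₀ d A).toLinearEquiv

/-- `L` is normal over `K` for `A_D` Galois. [cite: MochizukiFrdII2008, Def 2.2 (i) p.17] -/
theorem normal_objL (hA : A.base.obj.sg.toSubgroup.Normal) : Normal (baseFld p φ₀ hφ₀) (objL φ₀ hφ₀ d A) :=
  haveI := normal_objFldK φ₀ hφ₀ d A hA
  Normal.of_algEquiv (objLEquiv φ₀ hφ₀ d A)

/-- … indeed Galois over `K` ("`A_D` is Galois"; characteristic `0`). [cite: MochizukiFrdII2008, Def 2.2 (ii) p.17] -/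
theorem isGalois_objL (hA : A.base.obj.sg.toSubgroup.Normal) : IsGalois (baseFld p φ₀ hφ₀) (objL φ₀ hφ₀ d A) := by
  haveI := normal_objL φ₀ hφ₀ d A hA
  haveI : CharZero (baseFld p φ₀ hφ₀) :=
    charZero_of_injective_algebraMap (algebraMap ℚ_[p] (baseFld p φ₀ hφ₀)).injective
  haveI : Algebra.IsSeparable (baseFld p φ₀ hφ₀) (objL φ₀ hφ₀ d A) := inferInstance
  exact {}

/-- **The Galois chart of an object `A` (`A_D` Galois) of a `p`-adic Frobenioid over a GENERAL §2 base
`B^temp(Π, Π°)⁰ → B^temp(G, G°)⁰ → D₀`**: base field `K = ℚ̄_p^{φ₀(Π)}`, `χ : d.fld A_D ≅ g₁·K_A ≅ K_A ≅ L ⊆ K̄`,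
`res : Aut_C(A) ↠ Gal(L/K) ≅ Gal(K_A/K) = Aut_E(A_E)`. [cite: MochizukiFrdII2008, Def 2.2 (i) p.17] -/
def galoisChartRel (hA : A.base.obj.sg.toSubgroup.Normal) : d.GaloisChart A (baseFld p φ₀ hφ₀) (objL φ₀ hφ₀ d A) where
  χ := (fldEquiv φ₀ hφ₀ d hd A).trans ((twist φ₀ hφ₀ d A).trans (objLEquiv φ₀ hφ₀ d A).toRingEquiv)
  res := (AlgEquiv.autCongr (objLEquiv φ₀ hφ₀ d A)).toMonoidHom.comp (resK φ₀ hφ₀ d A)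
  res_apply α x := by
    apply congrArg (fun y : objL φ₀ hφ₀ d A => (y : AlgebraicClosure (baseFld p φ₀ hφ₀)))
    change objLEquiv φ₀ hφ₀ d A (resK φ₀ hφ₀ d A α ((objLEquiv φ₀ hφ₀ d A).symm
      (objLEquiv φ₀ hφ₀ d A (twist φ₀ hφ₀ d A (fldEquiv φ₀ hφ₀ d hd A x))))) =
      objLEquiv φ₀ hφ₀ d A (twist φ₀ hφ₀ d A (fldEquiv φ₀ hφ₀ d hd A ((d.toBaseZero.map α.inv).alg x)))
    rw [AlgEquiv.symm_apply_apply, resK_twist_fldEquiv]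
  res_surjective := (AlgEquiv.autCongr (objLEquiv φ₀ hφ₀ d A)).surjective.comp (resK_surjective φ₀ hφ₀ d A hA)

/-- `res` of the chart has the same kernel as `resK` (`= Ker(Aut_C(A) → Aut_E(A_E))`, `resK_eq_one_iff`).
[cite: MochizukiFrdII2008, Def 2.2 (i) p.17] -/
theorem galoisChartRel_res_eq_one_iff (hA : A.base.obj.sg.toSubgroup.Normal) (α : Aut A) :
    (galoisChartRel φ₀ hφ₀ d hd A hA).res α = 1 ↔
      (CosetCat.push φ₀ hφ₀.isOpenMap).map (ModelFrobenioid.baseMap α.inv).hom = 𝟙 _ := by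
  rw [← resK_eq_one_iff φ₀ hφ₀ d A α]
  change AlgEquiv.autCongr (objLEquiv φ₀ hφ₀ d A) (resK φ₀ hφ₀ d A α) = 1 ↔ _
  rw [MulEquiv.map_eq_one_iff]

/-! ### The Definition 2.2 context of an object over a general §2 base, and Theorem 2.4 (i) for such objects -/

/-- **Definition 2.2 for an object `A` (`A_D = Π/V`, `V ⊴ Π`) of a `p`-adic Frobenioid over a GENERAL base
`D = B^temp(Π, Π°)⁰ → E = B^temp(G, G°)⁰` of §2** and an open normal `H ⊆ G_K` (`K = ℚ̄_p^G`, `G = Im(Π)`; print's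
"`H ⊆ G` a normal open subgroup"): the context `Def22Context.ofChart` (file D3) of `galoisChartRel` — `Aut_C(A) ↷ O^▷(A)`,
`Aut_E(A_E) = Gal(L/K)`, `G := G_K ⊇ H`. [cite: MochizukiFrdII2008, Def 2.2 (i) p.17] -/
abbrev contextOfObjectRel (hA : A.base.obj.sg.toSubgroup.Normal)
    (H : Subgroup (absoluteGaloisGroup (baseFld p φ₀ hφ₀))) [H.Normal]
    (hH : IsOpen (H : Set (absoluteGaloisGroup (baseFld p φ₀ hφ₀)))) : PadicKummer.Def22Context :=
  haveI := finiteDimensional_objL φ₀ hφ₀ d A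
  haveI := normal_objL φ₀ hφ₀ d A hA
  PadicKummer.Def22Context.ofChart (galoisChartRel φ₀ hφ₀ d hd A hA) H hH

/-- `H` is locally compact for the object's context (`K ⊇ ℚ_p` finite; discharges the instance hypothesis of
`thm24i_ofObjectsRel`). [cite: MochizukiFrdII2008, Def 2.2 (i) p.17] -/
theorem locallyCompactSpace_H_contextOfObjectRel (hA : A.base.obj.sg.toSubgroup.Normal)
    (H : Subgroup (absoluteGaloisGroup (baseFld p φ₀ hφ₀))) [H.Normal]
    (hH : IsOpen (H : Set (absoluteGaloisGroup (baseFld p φ₀ hφ₀)))) :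
    LocallyCompactSpace (contextOfObjectRel φ₀ hφ₀ d hd A hA H hH).H :=
  haveI := finiteDimensional_objL φ₀ hφ₀ d A
  haveI := normal_objL φ₀ hφ₀ d A hA
  PadicKummer.Def22Context.locallyCompactSpace_H_ofChart (p₁ := p) (galoisChartRel φ₀ hφ₀ d hd A hA)

/-! ### Non-vacuity: the `p`-adic Frobenioid `C₀|_D` of Ex. 1.1 (ii) over `D = B^temp(Π, Π)⁰` -/

/-- The hypotheses `hd`, `hA` are inhabited for EVERY open homomorphism `φ₀ : Π → G_{ℚ_p}`: for the `p`-adic Frobenioid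
`C₀|_D` of Ex. 1.1 (ii) over `D = B^temp(Π, Π)⁰` (abc-iut-L1-t4's `Datum.zeroRelGal`, `hd := rfl`) and its object over
`Π/Π` with trivial class (`Π ⊴ Π`), `contextOfObjectRel` IS a Definition 2.2 context whose `Aut_C` is the object's
automorphism group (kernel witness that the construction elaborates on genuine data). [cite: MochizukiFrdII2008, Ex 1.1 (ii) p.8] -/
theorem contextOfObjectRel_zero_AutC (H : Subgroup (absoluteGaloisGroup (baseFld p φ₀ hφ₀))) [H.Normal]
    (hH : IsOpen (H : Set (absoluteGaloisGroup (baseFld p φ₀ hφ₀)))) :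
    let d₀ : Datum (RelCosetCat (⊤ : OpenSubgroup P)) p := Datum.zeroRelGal p ⊤ φ₀ hφ₀
    let A₀ : d₀.frobenioid := ⟨RelCosetCat.coset ⊤, 1⟩
    (contextOfObjectRel φ₀ hφ₀ d₀ rfl A₀ (inferInstanceAs ((⊤ : Subgroup P).Normal)) H hH).AutC = Aut A₀ :=
  rfl

end RelGal

end PadicFrd

/-! ### Theorem 2.4 (i) for two objects over general §2 bases -/

namespace PadicKummer.Def22Context

open CategoryTheory Field IntermediateField Kummer Function
open Literature.AnabelianGeometry.SemiGraphs QuasiTemperoid PadicFrd PadicFrd.Datum PadicFrd.RelGal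

variable {p₁ p₂ : ℕ} [Fact p₁.Prime] [Fact p₂.Prime]
  {P₁ : Type} [Group P₁] [TopologicalSpace P₁] {φ₁ : P₁ →* GalFbar ℚ_[p₁]} {hφ₁ : IsOpenHom φ₁} {P₁₀ : OpenSubgroup P₁}
  {d₁ : PadicFrd.Datum (RelCosetCat P₁₀) p₁} (hd₁ : d₁.base = relBaseGal p₁ P₁₀ φ₁ hφ₁) {A₁ : d₁.frobenioid}
  (hA₁ : A₁.base.obj.sg.toSubgroup.Normal)
  {P₂ : Type} [Group P₂] [TopologicalSpace P₂] {φ₂ : P₂ →* GalFbar ℚ_[p₂]} {hφ₂ : IsOpenHom φ₂} {P₂₀ : OpenSubgroup P₂}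
  {d₂ : PadicFrd.Datum (RelCosetCat P₂₀) p₂} (hd₂ : d₂.base = relBaseGal p₂ P₂₀ φ₂ hφ₂) {A₂ : d₂.frobenioid}
  (hA₂ : A₂.base.obj.sg.toSubgroup.Normal)
  {H₁ : Subgroup (absoluteGaloisGroup (baseFld p₁ φ₁ hφ₁))} [H₁.Normal]
  {hH₁ : IsOpen (H₁ : Set (absoluteGaloisGroup (baseFld p₁ φ₁ hφ₁)))}
  {H₂ : Subgroup (absoluteGaloisGroup (baseFld p₂ φ₂ hφ₂))} [H₂.Normal]
  {hH₂ : IsOpen (H₂ : Set (absoluteGaloisGroup (baseFld p₂ φ₂ hφ₂)))}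
  (e : Iso (contextOfObjectRel φ₁ hφ₁ d₁ hd₁ A₁ hA₁ H₁ hH₁) (contextOfObjectRel φ₂ hφ₂ d₂ hd₂ A₂ hA₂ H₂ hH₂)) (N : ℕ) [NeZero N]
  (hμ₁ : ∀ ζ : rootsOfUnity N (AlgebraicClosure (baseFld p₁ φ₁ hφ₁)),
    ((ζ : (AlgebraicClosure (baseFld p₁ φ₁ hφ₁))ˣ) : AlgebraicClosure (baseFld p₁ φ₁ hφ₁)) ∈ objL φ₁ hφ₁ d₁ A₁)
  (hμ₂ : ∀ ζ : rootsOfUnity N (AlgebraicClosure (baseFld p₂ φ₂ hφ₂)),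
    ((ζ : (AlgebraicClosure (baseFld p₂ φ₂ hφ₂))ˣ) : AlgebraicClosure (baseFld p₂ φ₂ hφ₂)) ∈ objL φ₂ hφ₂ d₂ A₂)
  [LocallyCompactSpace (contextOfObjectRel φ₁ hφ₁ d₁ hd₁ A₁ hA₁ H₁ hH₁).H]
  [LocallyCompactSpace (contextOfObjectRel φ₂ hφ₂ d₂ hd₂ A₂ hA₂ H₂ hH₂).H]

/-- **Theorem 2.4 (i) for two OBJECTS `Aᵢ` of `pᵢ`-adic Frobenioids over GENERAL §2 bases
`Dᵢ = B^temp(Πᵢ, Πᵢ°)⁰ → Eᵢ = B^temp(Gᵢ, Gᵢ°)⁰`, `Πᵢ → G_{ℚ_{pᵢ}}` any open homomorphism** (`(Aᵢ)_D` Galois,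
`μ_N(K̄ᵢ) ⊆ Lᵢ ≅ K_{Aᵢ}`, `A₁` `(N, H₁)`-saturated, any normalisation `F_N(A₁) ≅ ℤ/N`) and any isomorphism `e` of their
Definition 2.2 contexts "induced by `Ψ`": the typed `Thm24i` with the cup-product duality isomorphisms holds —
conditional on EXACTLY `hfs` ("`Φ₁` fieldwise saturated iff `Φ₂`", row L03); charts, descended actions,
`μ_N(Aᵢ) ≅ μ_N(K̄ᵢ)`, `p₁ = p₂`, local Tate duality over `Kᵢ = ℚ̄_{pᵢ}^{Im(Πᵢ)}`, saturation transfer and the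
Kummer/reciprocity compatibilities are CONSTRUCTED or PROVED (`thm24i_ofChart`). [cite: MochizukiFrdII2008, Thm 2.4 (i) p.19] -/
theorem thm24i_ofObjectsRel (fs₁ fs₂ : Prop) (hfs : fs₁ ↔ fs₂)
    (eFN₁ : FN (contextOfObjectRel φ₁ hφ₁ d₁ hd₁ A₁ hA₁ H₁ hH₁) N ≃+ ZMod N)
    (hc₁ : IsNHSaturated (contextOfObjectRel φ₁ hφ₁ d₁ hd₁ A₁ hA₁ H₁ hH₁) N) :
    haveI := finiteDimensional_objL φ₁ hφ₁ d₁ A₁; haveI := normal_objL φ₁ hφ₁ d₁ A₁ hA₁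
    haveI := finiteDimensional_objL φ₂ hφ₂ d₂ A₂; haveI := normal_objL φ₂ hφ₂ d₂ A₂ hA₂
    haveI := finiteDimensional_baseFld p₁ φ₁ hφ₁; haveI := finiteDimensional_baseFld p₂ φ₂ hφ₂
    letI := (galoisChartRel φ₁ hφ₁ d₁ hd₁ A₁ hA₁).galAction; letI := (galoisChartRel φ₂ hφ₂ d₂ hd₂ A₂ hA₂).galAction
    Thm24i (contextOfObjectRel φ₁ hφ₁ d₁ hd₁ A₁ hA₁ H₁ hH₁) (contextOfObjectRel φ₂ hφ₂ d₂ hd₂ A₂ hA₂ H₂ hH₂) N p₁ p₂ fs₁ fs₂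
      (e.thm24Data N)
      ((contextOfObjectRel φ₁ hφ₁ d₁ hd₁ A₁ hA₁ H₁ hH₁).dualityIsoOfLocalDuality N eFN₁ hc₁
        (cupDualH_bijective_ofGalois_mlf p₁ (objL φ₁ hφ₁ d₁ A₁) H₁ hH₁ (galoisChartRel φ₁ hφ₁ d₁ hd₁ A₁ hA₁).res
          (galoisChartRel φ₁ hφ₁ d₁ hd₁ A₁ hA₁).res_smul ((galoisChartRel φ₁ hφ₁ d₁ hd₁ A₁ hA₁).muModel N hμ₁)))
      ((contextOfObjectRel φ₂ hφ₂ d₂ hd₂ A₂ hA₂ H₂ hH₂).dualityIsoOfLocalDuality N ((e.isoFN N).symm.trans eFN₁)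
        ((e.isNHSaturated_iff N).mp hc₁)
        (cupDualH_bijective_ofGalois_mlf p₂ (objL φ₂ hφ₂ d₂ A₂) H₂ hH₂ (galoisChartRel φ₂ hφ₂ d₂ hd₂ A₂ hA₂).res
          (galoisChartRel φ₂ hφ₂ d₂ hd₂ A₂ hA₂).res_smul ((galoisChartRel φ₂ hφ₂ d₂ hd₂ A₂ hA₂).muModel N hμ₂))) :=
  haveI := finiteDimensional_objL φ₁ hφ₁ d₁ A₁; haveI := normal_objL φ₁ hφ₁ d₁ A₁ hA₁
  haveI := finiteDimensional_objL φ₂ hφ₂ d₂ A₂; haveI := normal_objL φ₂ hφ₂ d₂ A₂ hA₂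
  haveI := finiteDimensional_baseFld p₁ φ₁ hφ₁; haveI := finiteDimensional_baseFld p₂ φ₂ hφ₂
  thm24i_ofChart (galoisChartRel φ₁ hφ₁ d₁ hd₁ A₁ hA₁) (galoisChartRel φ₂ hφ₂ d₂ hd₂ A₂ hA₂) e N hμ₁ hμ₂ fs₁ fs₂ hfs eFN₁ hc₁

end PadicKummer.Def22Context

end Literature.AlgebraicGeometry.Frobenioids

end
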